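import Summits.CriticalPhenomena.PercolationContinuityZ3.Theorems.FK.Transplant.KNFreeRunReach
import HarnessLib

/-!
# FK-continuity transplant, FT-07 (d): the history-CONDITIONAL failure bound of one FK examination and of the run

Cell `fk-continuity` (bschramm), FRONTIER TRANSPLANT sub-cell, row FT-07 (`KNFreeTheorem6`, part d); support file
(`--supports stmt-CriticalPhenomena-4575`); builds on p205010 (kernel theorem, internal audit signed; external
expert review pending). HONEST FRAMING: the transplant this file serves is CONDITIONAL on the free-boundary
penetration hypothesis FH (open at the same `p` for `q > 1`; ⇔ GRC Conj. (5.103) via K1; barrier note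
`Literature.Barriers.CriticalPhenomena.SamePFreeBoundaryCriteria`); a typed reduction, not a proof of FK continuity.
THIS file is unconditional: no named facts, no sorries, standard axioms; `FH` does not occur in it.

## What is here

Kozma–Nitzan's (33) (arXiv:2401.12397 §4 p. 28: "P(v ∈ G_{i+1} | history) > 1 - ε") under the random-cluster law,
in the CONDITIONAL form consumed by the site renormalisation (C3b / FO-11): for an FK-valid history `h` and every
finite piece `Λ` carrying the examination regions, under the FREE law of `Λ` (`fkLaw Λ (restrW Λ (lattW d p)) q`,
`q ≥ 1`),
`φ_Λ({examination fails} ∩ [history]) ≤ (Σ_x P^x(bad_x)) · φ_Λ([history])`, because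

* conditioning on the history cylinder is pinning (P) and the bad event of direction `x` is DECREASING, so the
  conditioned law is bounded on it by the per-direction minimal law `P^x` restricted to `Sx` ((M) on decreasing
  events, REFUTER-REPORT F4 (b) = h_dec) — `condFail_dir_le`;
* `P^x` on `Λ` is `P^x` on `Sx` (support change, FT-06d) and a failed examination has a bad direction (FT-06a
  `not_succFK_subset`); at most `4` onward directions (FT-06b `measureReal_inter_le_of_subset_biUnion`) —
  `condFail_le`;
* along the run, with the per-direction bounds of `UFSC0` (FT-01) and FK-validity of every chosen history (FT-07 (c)
  `RunFK.validFK_of_choice`): `run_condFail_le`.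

## References

* G. Kozma, S. Nitzan, arXiv:2401.12397 (2024), §4 p. 28 ((33)), p. 31. [KozmaNitzan2024]
* G. Grimmett, *The Random-Cluster Model*, Springer 2006: Thm. (3.7), eq. (3.22), Lemma (4.13). [Grimmett2006]
-/

noncomputable section

open MeasureTheory Finset
open scoped ENNReal Classical

namespace Summit.CriticalPhenomena.PercolationContinuityZ3.Theorems.FK

open Literature.Probability.Percolation Literature.Probability.LatticeModels SimpleGraph
open Literature.Probability.Percolation.GadgetSystem Literature.Probability.Percolation.KozmaNitzan
open ProbeHistory HSiteScheme KSch Cells Transplant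

variable {d : ℕ} {S : KSch d} {q : ℝ}

/-- The per-direction minimal weighting `Wfull` is the history-pinned FREE weighting of any piece `Λ ⊇ Sx`,
restricted to `Sx`. [cite: KozmaNitzan2024, §4 p. 28 (Ω)] -/
theorem restrW_pinW_restrW_eq_Wfull {h : ProbeHistory (Site d)} {e : Site 2 × MDir} {du : MDir} {Λ : Finset (Site d)}
    (hΛ : S.Sx h e du ⊆ Λ) :
    restrW (↑(S.Sx h e du) : Set (Site d)) (pinW (restrW (↑Λ : Set (Site d)) (lattW d S.p)) ↑(S.F h) ↑(S.ξ h)) =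
      S.Wfull h e du := by
  funext x
  unfold KSch.Wfull
  by_cases hx : x ∈ wireSet (↑(S.Sx h e du) : Set (Site d))
  · rw [restrW_apply_of_mem _ hx, restrW_apply_of_mem _ hx]
    by_cases hxF : x ∈ (↑(S.F h) : Set (Sym2 (Site d)))
    · by_cases hxξ : x ∈ (↑(S.ξ h) : Set (Sym2 (Site d)))
      · rw [pinW_apply_of_mem_of_mem _ hxF hxξ, pinW_apply_of_mem_of_mem _ hxF hxξ]
      · rw [pinW_apply_of_mem_of_not_mem _ hxF hxξ, pinW_apply_of_mem_of_not_mem _ hxF hxξ]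
    · rw [pinW_apply_of_not_mem _ _ hxF, pinW_apply_of_not_mem _ _ hxF,
        restrW_apply_of_mem _ (KozmaNitzan.wireSet_mono (Finset.coe_subset.2 hΛ) hx)]
  · rw [restrW_apply_of_not_mem _ hx, restrW_apply_of_not_mem _ hx]

/-- **The conditional bound for one direction** (h_dec, REFUTER-REPORT F4 (b)): after an FK-valid history, for every
piece `Λ ⊇ Sx` and the free law `φ_Λ` of `Λ`, `φ_Λ(bad_x ∩ [history]) ≤ φ_Λ([history]) · P^x(bad_x)`: conditioning on
the history cylinder is pinning (P), `bad_x` is decreasing so the pinned law is bounded by its restriction to `Sx`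
((M)), which is `P^x` read on `Λ` (support change). [cite: KozmaNitzan2024, §4 p. 31; Grimmett2006, Thm. (3.7), eq. (3.22)] -/
theorem condFail_dir_le (hq : 1 ≤ q) {h : ProbeHistory (Site d)} {e : Site 2 × MDir} (hV : ValidFK S q h e)
    {du : MDir} (hdu : du ∈ S.onward h (tgt e)) {Λ : Finset (Site d)} (hΛ : S.Sx h e du ⊆ Λ) :
    (fkLaw Λ (restrW (↑Λ : Set (Site d)) (lattW d S.p)) q).real
        (badFK S q h e du ∩ localCylinder (↑(S.F h) : Set (Sym2 (Site d))) ↑(S.ξ h)) ≤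
      (fkLaw Λ (restrW (↑Λ : Set (Site d)) (lattW d S.p)) q).real (localCylinder (↑(S.F h) : Set (Sym2 (Site d))) ↑(S.ξ h)) *
        (fkLaw (S.Sx h e du) (S.Wfull h e du) q).real (badFK S q h e du) := by
  have hq0 : 0 < q := one_pos.trans_le hq
  have hL := isPinningLaw_fkLaw Λ hq
  have hLx := isPinningLaw_fkLaw (S.Sx h e du) hq
  have hdu' : du ∈ (geomTwin S).onward h (tgt e) := hdu
  have hV' : (geomTwin S).Valid h e := geomTwin_valid_of_validFK hV
  set WΛ := restrW (↑Λ : Set (Site d)) (lattW d S.p) with hWΛ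
  -- the revealed set lies in the pairs of `Λ`
  have hFw : (↑(S.F h) : Set (Sym2 (Site d))) ⊆ wireSet (↑(S.Sx h e du) : Set (Site d)) :=
    KSch.Valid.coe_F_subset_wireSet (S := geomTwin S) hV' (du := du)
  have hFD : (↑(S.F h) : Set (Sym2 (Site d))) ⊆ Set.range (Sym2.map (Subtype.val : ↥Λ → Site d)) :=
    hFw.trans ((KozmaNitzan.wireSet_mono (Finset.coe_subset.2 hΛ)).trans (wireSet_subset_range_sym2Map Λ))
  have hbadm : MeasurableSet (badFK S q h e du) := (determinedBy_badFK h e du).measurableSet_of_finset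
  -- (P): conditioning on the history cylinder is pinning
  rw [hL.pin WΛ (S.F h) hFD (S.ξ h) hV.ξ_sub _ hbadm]
  refine mul_le_mul_of_nonneg_left ?_ measureReal_nonneg
  -- (M) on the decreasing event: pinned law ≤ its restriction to `Sx`, which is `P^x` on `Λ`
  have hanti := hL.real_anti_of_isLowerSet (W := restrW (↑(S.Sx h e du) : Set (Site d)) (pinW WΛ ↑(S.F h) ↑(S.ξ h)))
    (W' := pinW WΛ ↑(S.F h) ↑(S.ξ h)) (fun x _ => by
      by_cases hx : x ∈ wireSet (↑(S.Sx h e du) : Set (Site d))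
      · rw [restrW_apply_of_mem _ hx]
      · rw [restrW_apply_of_not_mem _ hx]; exact bot_le)
    (isLowerSet_badFK hLx) hbadm
  refine hanti.trans (le_of_eq ?_)
  rw [restrW_pinW_restrW_eq_Wfull hΛ]
  have hW0 : FinSupp (S.Wfull h e du) (S.Sx h e du) := finSupp_restrW _ _
  rw [fkLaw_eq_of_subset hΛ hW0 hq0]

/-- **(33), conditional form**: after an FK-valid history, for every piece `Λ` containing the examination regions
`Sx` of all onward directions and per-direction minimal-law bounds `P^x(bad_x) ≤ ε` (e.g. from `UFSC0`), under the
free law of `Λ` the examination fails on at most a `4ε`-fraction of the history cylinder: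
`φ_Λ({¬succ} ∩ [history]) ≤ 4ε · φ_Λ([history])`. [cite: KozmaNitzan2024, §4 p. 28 ((33))] -/
theorem condFail_le (hq : 1 ≤ q) {h : ProbeHistory (Site d)} {e : Site 2 × MDir} (hV : ValidFK S q h e)
    {Λ : Finset (Site d)} (hΛ : ∀ du ∈ S.onward h (tgt e), S.Sx h e du ⊆ Λ) {ε : ℝ} (hε : 0 ≤ ε)
    (hb : ∀ du ∈ S.onward h (tgt e), (fkLaw (S.Sx h e du) (S.Wfull h e du) q).real (badFK S q h e du) ≤ ε) :
    (fkLaw Λ (restrW (↑Λ : Set (Site d)) (lattW d S.p)) q).real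
        ({ω | ¬succFK S q h e ((probeFK S q h e).read ω)} ∩ localCylinder (↑(S.F h) : Set (Sym2 (Site d))) ↑(S.ξ h)) ≤
      (4 * ε) * (fkLaw Λ (restrW (↑Λ : Set (Site d)) (lattW d S.p)) q).real
        (localCylinder (↑(S.F h) : Set (Sym2 (Site d))) ↑(S.ξ h)) := by
  haveI := (isPinningLaw_fkLaw Λ hq).prob (restrW (↑Λ : Set (Site d)) (lattW d S.p))
  have hcard : (S.onward h (tgt e)).card ≤ 4 := by
    have h1 : (S.onward h (tgt e)).card ≤ Fintype.card MDir := Finset.card_le_univ _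
    have h2 : Fintype.card MDir = 4 := by simp [MDir, Fintype.card_prod, Fintype.card_bool, Fintype.card_fin]
    omega
  have h4ε : 0 ≤ 4 * ε := by positivity
  have key := measureReal_inter_le_of_subset_biUnion (fkLaw Λ (restrW (↑Λ : Set (Site d)) (lattW d S.p)) q)
    (S.onward h (tgt e)) hcard (fun du => badFK S q h e du) (C := localCylinder (↑(S.F h) : Set (Sym2 (Site d))) ↑(S.ξ h))
    (not_succFK_subset S q h e) h4ε (fun du hdu => ?_)
  · exact key
  · have hdir := condFail_dir_le hq hV hdu (hΛ du hdu)
    calc (fkLaw Λ (restrW (↑Λ : Set (Site d)) (lattW d S.p)) q).real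
          (badFK S q h e du ∩ localCylinder (↑(S.F h) : Set (Sym2 (Site d))) ↑(S.ξ h))
        ≤ (fkLaw Λ (restrW (↑Λ : Set (Site d)) (lattW d S.p)) q).real (localCylinder (↑(S.F h) : Set (Sym2 (Site d))) ↑(S.ξ h)) *
            ε := hdir.trans (mul_le_mul_of_nonneg_left (hb du hdu) measureReal_nonneg)
      _ = ε * _ := mul_comm _ _
      _ ≤ 4 * ε / ↑(4 : ℕ) * (fkLaw Λ (restrW (↑Λ : Set (Site d)) (lattW d S.p)) q).real
            (localCylinder (↑(S.F h) : Set (Sym2 (Site d))) ↑(S.ξ h)) := by norm_num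

/-- **(33) along the run**: if `S` witnesses the two clauses of `UFSC0` ((32)-FK at the origin in every direction and
the per-direction minimal-law bound `≤ ε₀` after every FK-valid history), then at every step of the FK run at which a
macro-edge is chosen, the examination fails on at most a `4ε₀`-fraction of the history cylinder under the free law
of any piece `Λ` containing the examination regions — the history-conditional twin of tree `KSch.lawful`'s `fail`.
[cite: KozmaNitzan2024, §4 pp. 25–31 ((32), (33))] -/
theorem run_condFail_le (hq : 1 ≤ q) {ε₀ : ℝ} (hε₀ : 0 ≤ ε₀) (hQ0 : ∀ du : MDir, OriginFK S q du)
    (hbad : ∀ (h : ProbeHistory (Site d)) (e : Site 2 × MDir) (du : MDir), ValidFK S q h e →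
      du ∈ S.onward h (tgt e) → (fkLaw (S.Sx h e du) (S.Wfull h e du) q).real (badFK S q h e du) ≤ ε₀)
    {ω₀ : BondConfig (Site d)} {n : ℕ} {e : Site 2 × MDir} (hc : ((schemeFK S q).stN n ω₀).choice = some e)
    {Λ : Finset (Site d)} (hΛ : ∀ du ∈ S.onward (RunFK.hst S q ω₀ n) (tgt e), S.Sx (RunFK.hst S q ω₀ n) e du ⊆ Λ) :
    (fkLaw Λ (restrW (↑Λ : Set (Site d)) (lattW d S.p)) q).real
        ({ω | ¬succFK S q (RunFK.hst S q ω₀ n) e ((probeFK S q (RunFK.hst S q ω₀ n) e).read ω)} ∩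
          localCylinder (↑(S.F (RunFK.hst S q ω₀ n)) : Set (Sym2 (Site d))) ↑(S.ξ (RunFK.hst S q ω₀ n))) ≤
      (4 * ε₀) * (fkLaw Λ (restrW (↑Λ : Set (Site d)) (lattW d S.p)) q).real
        (localCylinder (↑(S.F (RunFK.hst S q ω₀ n)) : Set (Sym2 (Site d))) ↑(S.ξ (RunFK.hst S q ω₀ n))) := by
  have hV : ValidFK S q (RunFK.hst S q ω₀ n) e := RunFK.validFK_of_choice hq hQ0 hc
  exact condFail_le hq hV hΛ hε₀ fun du hdu => hbad _ _ du hV hdu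

end Summit.CriticalPhenomena.PercolationContinuityZ3.Theorems.FK

end
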